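import Mathlib.Algebra.Polynomial.SpecificDegree
import Mathlib.RingTheory.PrincipalIdealDomain
import Mathlib.Analysis.Complex.Polynomial.Basic
import Summits.KontsevichZagierPeriods.KontsevichZagierPeriods.Theorems.HurwitzMicroSectorsNormalFormPrincipleAngBaker

/-!
# `NormalFormPrinciple` (stmt-KontsevichZagierPeriods-3869), line `SketchIdeator1` —
# the leaf `stub_boxRigidity` in dimension one — non-real roots: the real quadratic factor and its peeling

Pure proof file (lead seat c3; `--supports` the crux), algebra only. For `q ∈ K[X]` (`K` the real
algebraic numbers) dividing a rational polynomial: complex conjugation permutes the complex roots; a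
non-real root `z` yields the factor `(X − Re z)² + (Im z)² ∣ q` in `K[X]`; hence `q` has a root in `K` or
such a quadratic factor (`exists_root_or_quad`); and one peeling step
`p/q = (At + B)/((t−u)²+v²)^{n+1} + p₁/q₁` with `deg q₁ < deg q` (`exists_peel_quad`, Bezout with the
irreducible quadratic).

Sources: folklore (partial fractions over a real closed field). No definitions are introduced.
-/

noncomputable section

open Finset
open scoped Polynomial

namespace Summit.KontsevichZagierPeriods.HurwitzMicroSectors.NormalFormPrinciple.PiBox

namespace Dlog

/-! ## Complex roots of polynomials with real algebraic coefficients -/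

/-- Complex conjugation permutes the complex roots of a polynomial with real algebraic coefficients.
[folklore] -/
theorem isRoot_conj {q : (algebraicClosure ℚ ℝ)[X]} {z : ℂ}
    (hz : (q.map (Complex.ofRealHom.comp (algebraMap (algebraicClosure ℚ ℝ) ℝ))).IsRoot z) :
    (q.map (Complex.ofRealHom.comp (algebraMap (algebraicClosure ℚ ℝ) ℝ))).IsRoot
      (starRingEnd ℂ z) := by
  set φ := Complex.ofRealHom.comp (algebraMap (algebraicClosure ℚ ℝ) ℝ) with hφ
  have hconj : (starRingEnd ℂ).comp φ = φ := by
    refine RingHom.ext fun k => ?_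
    show starRingEnd ℂ (((k:ℝ):ℂ)) = ((k:ℝ):ℂ)
    exact Complex.conj_ofReal _
  rw [Polynomial.IsRoot.def, Polynomial.eval_map] at hz ⊢
  have h := Polynomial.hom_eval₂ q φ (starRingEnd ℂ) z
  rw [hconj, hz, map_zero] at h
  exact h.symm

/-- **The real quadratic factor of a non-real root.** If `z` (`Im z ≠ 0`) is a complex root of
`q ∈ K[X]` (`K` the real algebraic numbers) and `u = Re z`, `v² = (Im z)²` in `K`, then
`(X − u)² + v²` divides `q` in `K[X]`. [folklore] -/
theorem quad_dvd_of_isRoot {q : (algebraicClosure ℚ ℝ)[X]} {z : ℂ}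
    (hz : (q.map (Complex.ofRealHom.comp (algebraMap (algebraicClosure ℚ ℝ) ℝ))).IsRoot z)
    (him : z.im ≠ 0) (u v : algebraicClosure ℚ ℝ) (hu : (u : ℝ) = z.re) (hv : (v : ℝ) ^ 2 = z.im ^ 2) :
    ((Polynomial.X - Polynomial.C u) ^ 2 + Polynomial.C (v ^ 2)) ∣ q := by
  set φ := Complex.ofRealHom.comp (algebraMap (algebraicClosure ℚ ℝ) ℝ) with hφ
  have hz' := isRoot_conj hz
  have hne : starRingEnd ℂ z ≠ z := fun h => him (Complex.conj_eq_iff_im.mp h)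
  obtain ⟨P₁, hP₁⟩ := Polynomial.dvd_iff_isRoot.mpr hz
  have hz₁ : P₁.IsRoot (starRingEnd ℂ z) := by
    have h := hz'
    rw [hP₁, Polynomial.IsRoot.def, Polynomial.eval_mul, Polynomial.eval_sub, Polynomial.eval_X,
      Polynomial.eval_C] at h
    exact (mul_eq_zero.mp h).resolve_left (sub_ne_zero.mpr hne)
  obtain ⟨P₂, hP₂⟩ := Polynomial.dvd_iff_isRoot.mpr hz₁
  have hdvdC : (Polynomial.X - Polynomial.C z) * (Polynomial.X - Polynomial.C (starRingEnd ℂ z)) ∣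
      q.map φ := ⟨P₂, by rw [hP₁, hP₂, mul_assoc]⟩
  have hmap : ((Polynomial.X - Polynomial.C u) ^ 2 + Polynomial.C (v ^ 2) :
      (algebraicClosure ℚ ℝ)[X]).map φ =
      (Polynomial.X - Polynomial.C z) * (Polynomial.X - Polynomial.C (starRingEnd ℂ z)) := by
    simp only [Polynomial.map_add, Polynomial.map_pow, Polynomial.map_sub, Polynomial.map_X,
      Polynomial.map_C]
    have e1 : φ u = (z.re : ℂ) := by show ((u:ℝ):ℂ) = _; rw [hu]
    have e2 : φ (v ^ 2) = ((z.im ^ 2 : ℝ) : ℂ) := by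
      rw [map_pow]; show ((v:ℝ):ℂ) ^ 2 = _; rw [← Complex.ofReal_pow, hv]
    rw [e1, e2]
    have hz1 : Polynomial.C z = Polynomial.C (z.re : ℂ) + Polynomial.C ((z.im : ℂ) * Complex.I) := by
      rw [← map_add]; congr 1; exact (Complex.re_add_im z).symm
    have hz2 : Polynomial.C (starRingEnd ℂ z) =
        Polynomial.C (z.re : ℂ) - Polynomial.C ((z.im : ℂ) * Complex.I) := by
      rw [← map_sub]; congr 1
      apply Complex.ext <;> simp
    have e3 : (Polynomial.C ((z.im : ℂ) * Complex.I)) ^ 2 = -Polynomial.C (((z.im ^ 2 : ℝ)) : ℂ) := by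
      rw [← map_pow, mul_pow, Complex.I_sq, ← map_neg]
      congr 1
      push_cast
      ring
    rw [hz1, hz2]
    linear_combination e3
  rw [← Polynomial.map_dvd_map' φ, hmap]
  exact hdvdC

/-- **A root or a quadratic factor.** Let `q ∈ K[X]` (`K` the real algebraic numbers) be
non-constant and divide the image of some nonzero `q₀ ∈ ℚ[X]`. Then either `q` has a root in `K`, or
`(X − u)² + v²` divides `q` for some `u, v ∈ K` with `v > 0`. [folklore] -/
theorem exists_root_or_quad (q : (algebraicClosure ℚ ℝ)[X]) (hdeg : 0 < q.natDegree) {q₀ : ℚ[X]}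
    (hq₀ : q₀ ≠ 0) (hdvd : q ∣ q₀.map (algebraMap ℚ (algebraicClosure ℚ ℝ))) :
    (∃ ρ : algebraicClosure ℚ ℝ, q.IsRoot ρ) ∨
      ∃ u v : algebraicClosure ℚ ℝ, 0 < (v : ℝ) ∧
        ((Polynomial.X - Polynomial.C u) ^ 2 + Polynomial.C (v ^ 2)) ∣ q := by
  set φ := Complex.ofRealHom.comp (algebraMap (algebraicClosure ℚ ℝ) ℝ) with hφ
  have hφk : ∀ k : algebraicClosure ℚ ℝ, φ k = ((k:ℝ):ℂ) := fun _ => rfl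
  -- a complex root
  have hdegC : 0 < (q.map φ).degree := by
    rw [Polynomial.degree_map]
    exact Polynomial.natDegree_pos_iff_degree_pos.mp hdeg
  obtain ⟨z, hz⟩ := Complex.exists_root hdegC
  -- it is algebraic over `ℚ`
  have hzalg : IsAlgebraic ℚ z := by
    have h1 : q.map φ ∣ (q₀.map (algebraMap ℚ (algebraicClosure ℚ ℝ))).map φ :=
      Polynomial.map_dvd φ hdvd
    rw [Polynomial.map_map] at h1
    have hcomp : φ.comp (algebraMap ℚ (algebraicClosure ℚ ℝ)) = algebraMap ℚ ℂ :=
      RingHom.ext fun r => by rw [eq_ratCast, eq_ratCast]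
    rw [hcomp] at h1
    have hroot : (q₀.map (algebraMap ℚ ℂ)).IsRoot z := Polynomial.IsRoot.dvd hz h1
    refine ⟨q₀, hq₀, ?_⟩
    rwa [Polynomial.IsRoot.def, Polynomial.eval_map, ← Polynomial.aeval_def] at hroot
  by_cases him : z.im = 0
  · left
    refine ⟨⟨z.re, mem_algebraicClosure_iff.mpr (Literature.NumberTheory.Transcendental.isAlgebraic_re_im hzalg).1⟩, ?_⟩
    have hzre : ((z.re : ℝ) : ℂ) = z := by
      apply Complex.ext <;> simp [him]
    apply φ.injective
    rw [map_zero, ← Polynomial.eval₂_hom, ← Polynomial.eval_map, hφk]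
    show (q.map φ).eval (((z.re : ℝ)) : ℂ) = 0
    rw [hzre]
    exact hz
  · right
    have hre := (Literature.NumberTheory.Transcendental.isAlgebraic_re_im hzalg).1
    have himA : IsAlgebraic ℚ |z.im| := by
      rcases abs_choice z.im with h | h <;> rw [h]
      · exact (Literature.NumberTheory.Transcendental.isAlgebraic_re_im hzalg).2
      · exact (Literature.NumberTheory.Transcendental.isAlgebraic_re_im hzalg).2.neg
    refine ⟨⟨z.re, mem_algebraicClosure_iff.mpr hre⟩, ⟨|z.im|, mem_algebraicClosure_iff.mpr himA⟩,
      abs_pos.mpr him, quad_dvd_of_isRoot hz him _ _ rfl (sq_abs z.im)⟩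

/-! ## One peeling step of a quadratic factor -/

/-- **Peeling a quadratic factor.** If `Q = (X − u)² + v²` (`u, v ∈ K ⊆ ℝ`, `v ≠ 0`) divides
`q ≠ 0` in `K[X]`, then `p/q = (A t + B)/((t − u)² + v²)^{n+1} + p₁/q₁` wherever `q(t) ≠ 0`, with
`A, B ∈ K` and `q₁` a proper divisor of `q`. (Bezout with the irreducible `Q`.) [folklore] -/
theorem exists_peel_quad (p q : (algebraicClosure ℚ ℝ)[X]) (hq : q ≠ 0) {u v : algebraicClosure ℚ ℝ}
    (hv : (v : ℝ) ≠ 0) (hdvd : ((Polynomial.X - Polynomial.C u) ^ 2 + Polynomial.C (v ^ 2)) ∣ q) :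
    ∃ (n : ℕ) (A B : algebraicClosure ℚ ℝ) (p₁ q₁ : (algebraicClosure ℚ ℝ)[X]),
      q₁ ≠ 0 ∧ q₁.natDegree < q.natDegree ∧ q₁ ∣ q ∧
      ∀ t : ℝ, (Polynomial.aeval t q : ℝ) ≠ 0 →
        (Polynomial.aeval t p : ℝ) / Polynomial.aeval t q =
          ((A : ℝ) * t + B) / ((t - u) ^ 2 + (v : ℝ) ^ 2) ^ (n + 1) +
            (Polynomial.aeval t p₁ : ℝ) / Polynomial.aeval t q₁ := by
  set Q : (algebraicClosure ℚ ℝ)[X] := (Polynomial.X - Polynomial.C u) ^ 2 + Polynomial.C (v ^ 2)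
    with hQ
  -- `Q` is monic of degree two without roots in `K`, hence irreducible
  have hQdeg2 : ((Polynomial.X - Polynomial.C u) ^ 2 : (algebraicClosure ℚ ℝ)[X]).natDegree = 2 := by
    rw [Polynomial.natDegree_pow, Polynomial.natDegree_X_sub_C]
  have hQm : Q.Monic := by
    rw [hQ]
    refine ((Polynomial.monic_X_sub_C u).pow 2).add_of_left ?_
    refine (Polynomial.degree_C_le).trans_lt ?_
    exact Polynomial.natDegree_pos_iff_degree_pos.mp (by rw [hQdeg2]; exact two_pos)
  have hQdeg : Q.natDegree = 2 := by
    rw [hQ, Polynomial.natDegree_add_C, hQdeg2]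
  have hQeval : ∀ t : ℝ, (Polynomial.aeval t Q : ℝ) = (t - u) ^ 2 + (v:ℝ) ^ 2 := by
    intro t
    rw [hQ]
    simp only [map_add, map_pow, map_sub, Polynomial.aeval_X, Polynomial.aeval_C]
    rfl
  have hQpos : ∀ t : ℝ, 0 < (t - u) ^ 2 + (v:ℝ) ^ 2 := fun t =>
    add_pos_of_nonneg_of_pos (sq_nonneg _) (lt_of_le_of_ne (sq_nonneg _) (Ne.symm (pow_ne_zero 2 hv)))
  have hQnoroot : ∀ x : algebraicClosure ℚ ℝ, ¬ Q.IsRoot x := by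
    intro x hx
    have h : (Polynomial.aeval (x:ℝ) Q : ℝ) = 0 := by
      have e : (x:ℝ) = algebraMap (algebraicClosure ℚ ℝ) ℝ x := rfl
      rw [e, Polynomial.aeval_algebraMap_apply_eq_algebraMap_eval, hx.eq_zero, map_zero]
    rw [hQeval] at h
    exact (hQpos x).ne' h
  have hQirr : Irreducible Q :=
    Polynomial.irreducible_of_degree_le_three_of_not_isRoot
      (by rw [hQdeg]; exact Finset.mem_Icc.mpr ⟨by norm_num, by norm_num⟩) hQnoroot
  have hQ1 : Q ≠ 1 := by
    intro h; have := congrArg Polynomial.natDegree h; rw [hQdeg, Polynomial.natDegree_one] at this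
    exact two_ne_zero this
  have hQ0 : Q ≠ 0 := hQm.ne_zero
  -- maximal power of `Q` in `q`
  obtain ⟨m, q₂, hndvd, hq₂⟩ := WfDvdMonoid.max_power_factor hq hQirr
  have hq₂0 : q₂ ≠ 0 := by
    intro h
    apply hq
    rw [hq₂, h, mul_zero]
  have hm : m ≠ 0 := by
    intro h
    rw [h, pow_zero, one_mul] at hq₂
    apply hndvd
    rw [← hq₂]
    exact hdvd
  obtain ⟨n, rfl⟩ : ∃ n, m = n + 1 := ⟨m - 1, by omega⟩
  -- Bezout
  obtain ⟨a, b, hab⟩ := (hQirr.coprime_iff_not_dvd.mpr hndvd)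
  set L : (algebraicClosure ℚ ℝ)[X] := (p * b) %ₘ Q with hL
  have hLdeg : L.natDegree ≤ 1 := by
    have := Polynomial.natDegree_modByMonic_lt (p * b) hQm hQ1
    rw [hQdeg] at this
    rw [hL]
    omega
  have hLeq : L = Polynomial.C (L.coeff 1) * Polynomial.X + Polynomial.C (L.coeff 0) :=
    Polynomial.eq_X_add_C_of_natDegree_le_one hLdeg
  set p₁ : (algebraicClosure ℚ ℝ)[X] := p * a + (p * b /ₘ Q) * q₂ with hp₁
  set q₁ : (algebraicClosure ℚ ℝ)[X] := Q ^ n * q₂ with hq₁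
  have hpeq : p = Q * p₁ + L * q₂ := by
    have h1 : p = p * (a * Q + b * q₂) := by rw [hab, mul_one]
    have h2 : p * b = L + Q * (p * b /ₘ Q) := (Polynomial.modByMonic_add_div (p * b) Q).symm
    rw [hp₁]
    linear_combination h1 + q₂ * h2
  refine ⟨n, L.coeff 1, L.coeff 0, p₁, q₁, mul_ne_zero (pow_ne_zero _ hQ0) hq₂0, ?_, ?_, ?_⟩
  · have hdq : q.natDegree = (n + 1) * 2 + q₂.natDegree := by
      rw [hq₂, Polynomial.natDegree_mul (pow_ne_zero _ hQ0) hq₂0, Polynomial.natDegree_pow, hQdeg]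
    have hdq₁ : q₁.natDegree = n * 2 + q₂.natDegree := by
      rw [hq₁, Polynomial.natDegree_mul (pow_ne_zero _ hQ0) hq₂0, Polynomial.natDegree_pow, hQdeg]
    omega
  · exact ⟨Q, by rw [hq₂, hq₁, pow_succ]; ring⟩
  · intro t ht
    have hqt : (Polynomial.aeval t q : ℝ) = ((t - u) ^ 2 + (v:ℝ) ^ 2) ^ (n + 1) * Polynomial.aeval t q₂ := by
      rw [hq₂, map_mul, map_pow, hQeval]
    have hq₁t : (Polynomial.aeval t q₁ : ℝ) = ((t - u) ^ 2 + (v:ℝ) ^ 2) ^ n * Polynomial.aeval t q₂ := by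
      rw [hq₁, map_mul, map_pow, hQeval]
    have hq₂t : (Polynomial.aeval t q₂ : ℝ) ≠ 0 := by
      intro h; apply ht; rw [hqt, h, mul_zero]
    have hLt : (Polynomial.aeval t L : ℝ) = (L.coeff 1 : ℝ) * t + L.coeff 0 := by
      conv_lhs => rw [hLeq]
      rw [map_add, map_mul, Polynomial.aeval_C, Polynomial.aeval_X, Polynomial.aeval_C]
      rfl
    have hpt : (Polynomial.aeval t p : ℝ) =
        ((t - u) ^ 2 + (v:ℝ) ^ 2) * Polynomial.aeval t p₁ + ((L.coeff 1 : ℝ) * t + L.coeff 0) *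
          Polynomial.aeval t q₂ := by
      conv_lhs => rw [hpeq]
      rw [map_add, map_mul, map_mul, hQeval, hLt]
    rw [hqt, hq₁t, hpt]
    have hQt := (hQpos t).ne'
    field_simp
    ring

end Dlog

end Summit.KontsevichZagierPeriods.HurwitzMicroSectors.NormalFormPrinciple.PiBox
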